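import Literature.AlgebraicGeometry.Resolution.HironakaGroupScheme
import HarnessLib.Audit
import HarnessLib

/-!
# Mizutani's conjecture `m(e) = 2p^e − 1` — the obligation (statement only)

Cell topic `Summits/ResolutionOfSingularities/KangarooAtlas` (pub-rosobs); namespace
`Summit.ResolutionOfSingularities.KangarooAtlas.Mizutani`.  H. Mizutani, Nagoya Math. J. 52 (1973),
Remark 2.10: "let `m(e)` be the smallest dimension of H-schemes whose exponents are not less than `e`
… It is quite likely that `m(e) = 2p^e − 1`."  With the vocabulary of
`Literature/AlgebraicGeometry/Resolution/HironakaGroupScheme.lean` (Oda's printed description of the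
invariant additive forms, exponent and dimension of the Hironaka subgroup scheme `B(𝔭)` of a point
`𝔭` of `ℙ^n_k`):

* `MizutaniLowerBound p e` — `m(e) ≥ 2p^e − 1`: every `B(𝔭)` of (finite) exponent `≥ e` has dimension
  `≥ 2p^e − 1`.  In print: `e = 0` trivial, `e = 1` is Mizutani's Thm. 2.8 (`Mizutani1973_m_one`), `e ≥ 2`
  not proved in 1973 ("It is quite likely that …").  The pub-rosobs cell's in-house note MIZUTANI-PROOF-g59
  (AI-written, AI-audited, NOT refereed; *AI review is weaker than expert review*) claims it, and the Lean
  chain of this directory PROVES it for every `p` and `e`: THEOREM F (`theoremF_rootTower`,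
  `MizutaniTheoremF.lean`; hypothesis-free `theoremF_of_mem_pow'`, `MizutaniRootTowerDegree.lean`) + the
  §3 dictionary (`MizutaniDiffPairing.lean` … `MizutaniLowerBound.lean`) give
  `mizutaniLowerBound : ∀ p e, MizutaniLowerBound p e` (p496991) with NO named fact and NO displayed
  hypothesis.
* `MizutaniConjecture p e` — `m(e) = 2p^e − 1`: the lower bound together with the attainment
  `MizutaniAttained` (a point of `ℙ^{2p^e−1}` with exponent exactly `e` and `dim B = 2p^e − 1`).  PROVED:
  `mizutaniAttained` (`MizutaniAttained.lean`, over `𝔽_p(u_0,u_1)`; `mizutaniAttained_of_lt_rank`,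
  `MizutaniAttainedGeneral.lean`, over every field with `[k : k^p] ≥ p²`), hence
  `mizutaniConjecture : ∀ p e, MizutaniConjecture p e` (`MizutaniConjectureHolds.lean`, p501710), and as an
  EQUATION `mizutaniNumber_eq : mizutaniNumber p e = 2 * p ^ e − 1` (`MizutaniNumber.lean`).  The attaining
  point of the tree (`attP`, `MizutaniAttainedPoint.lean`; `GenAtt.attP`, `MizutaniAttainedGeneralPoint.lean`)
  is the LEVEL-`e` ANALOGUE OF MIZUTANI'S EXAMPLE 2.1 over a field with a `p`-independent PAIR `u_0, u_1`
  (invariant form `Σ_{j<q} u_1^{q−1−j}(u_0 x_{0j}^q − x_{1j}^q)`, `q = p^e`); it is NOT literally Mizutani's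
  `H_e` of Remark 2.10, which is sketched there inductively ("H_2, H_3, …, H_e") from Example 2.1 with a
  FRESH `p`-basis element at each step (so over a field of `p`-rank `≥ e + 1`).  Both have exponent `e` and
  dimension `2p^e − 1` (Remark 2.10: "e(H_e) = e and dim H_e = 2p^e − 1"); for `e = 1` both are Example 2.1
  (up to renaming the `2p` coordinates and signs).
* Base field, stated exactly: the lower bound holds over EVERY field `k` of characteristic `p`; it is
  attained over `k` (for every `e ≥ 1`) iff `[k : k^p] ≥ p²` (`exponent_dichotomy`,
  `MizutaniAttainedGeneral.lean`); over a field with `[k : k^p] ≤ p` every `B(𝔭)` is a vector group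
  (`exponentLE_zero_of_rank_le`, `MizutaniPDegree.lean`), so Mizutani's fixed-field `m_k(e)` is not attained
  there.  `m(e)` in the sense of Remark 2.10 (minimum over all fields of characteristic `p` and all points) is
  `mizutaniNumber p e`.
* In Hironaka's / Mizutani's own vocabulary (`U(𝔭)`, `B_{P,𝔭} = Spec S/U_+(𝔭)S` of
  `Literature/…/HironakaGroupSchemeMultiplicity.lean`): `mizutani_lowerBound_hironaka`,
  `mizutani_attained_hironaka` (`MizutaniHironakaSide.lean`), via Oda's equality `hirForms_eq_invForms`
  (`MizutaniOdaEquality.lean`, Oda 1973 Prop. 2.2 (ii), PROVED) — see the cell's MIZUTANI-LEAN.md.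

The two `def`s below stay `@[conjecture]` obligation NODES (the cell's bookkeeping attribute: a node is a
statement; its proof is a separate declaration); they are asserted by `mizutaniLowerBound` /
`mizutaniConjecture`, not here.  Not a resolution theorem; NOT summit progress (summit relevance C).
AI review is weaker than expert review; no human expert has refereed the note or the Lean.
-/

namespace Summit.ResolutionOfSingularities.KangarooAtlas.Mizutani

open Literature.AlgebraicGeometry.Resolution.HironakaScheme

universe u

/-- **`m(e) ≥ 2p^e − 1`** (Mizutani 1973, Remark 2.10, the substantive half of "`m(e) = 2p^e − 1`"):
for every field `k` of characteristic `p`, every `n`, every point `𝔭` of `ℙ^n_k` and every `e₀` with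
`exponent(B(𝔭)) ≤ e₀` but `exponent(B(𝔭)) ≰ e'` for all `e' < e`, the dimension of the Hironaka
subgroup scheme `B(𝔭)` (Oda's formula, read at level `e₀`) is `≥ 2p^e − 1`.  Not proved in print for
`e ≥ 2` (Remark 2.10: "quite likely"); PROVED in the tree for all `p`, `e`: `mizutaniLowerBound`
(`MizutaniLowerBound.lean`), in Hironaka's vocabulary `mizutani_lowerBound_hironaka` (`MizutaniHironakaSide.lean`).
This `def` is the obligation NODE (statement only). [cite: Mizutani1973HironakaGroupSchemes, Remark 2.10] -/
@[conjecture] def MizutaniLowerBound (p : ℕ) [Fact p.Prime] (e : ℕ) : Prop :=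
  ∀ (k : Type u) [Field k] [CharP k p] (n : ℕ) (𝔭 : Ideal (MvPolynomial (Fin (n + 1)) k)) (e₀ : ℕ),
    IsPoint k 𝔭 → ExponentLE k p 𝔭 e₀ → (∀ e', e' < e → ¬ ExponentLE k p 𝔭 e') →
      2 * p ^ e ≤ hsDimAt k p 𝔭 e₀ + 1

/-- **MIZUTANI'S CONJECTURE `m(e) = 2p^e − 1`** (Remark 2.10): the lower bound `MizutaniLowerBound`
together with the attainment `MizutaniAttained` (a point of `ℙ^{2p^e−1}_k` over SOME field `k` of
characteristic `p` with exponent exactly `e` and `dim B = 2p^e − 1`; PROVED as `mizutaniAttained`,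
`MizutaniAttained.lean`, by the level-`e` analogue of Mizutani's Example 2.1 over `𝔽_p(u_0,u_1)` — cf. his
inductive `H_e`).  The conjunction is PROVED: `mizutaniConjecture` (`MizutaniConjectureHolds.lean`); as a number,
`mizutaniNumber_eq` (`MizutaniNumber.lean`).  This `def` is the obligation NODE (statement only).
[cite: Mizutani1973HironakaGroupSchemes, Remark 2.10 ("It is quite likely that m(e) = 2p^e − 1")] -/
@[conjecture] def MizutaniConjecture (p : ℕ) [Fact p.Prime] (e : ℕ) : Prop :=
  MizutaniLowerBound.{u} p e ∧ MizutaniAttained.{u} p e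

/-- For `e = 1` the lower bound is exactly Mizutani's theorem (the named fact `Mizutani1973_m_one`,
Thm. 2.8 first part — discharged in the tree as `mizutani1973_m_one`, `MizutaniConjectureHolds.lean`):
`exponent ≥ 1` means `¬ exponent ≤ 0`. [cite: Mizutani1973HironakaGroupSchemes, Theorem 2.8] -/
theorem mizutaniLowerBound_one_iff (p : ℕ) [Fact p.Prime] :
    MizutaniLowerBound.{u} p 1 ↔ Mizutani1973_m_one.{u} p := by
  unfold MizutaniLowerBound Mizutani1973_m_one
  constructor
  · intro h k _ _ n 𝔭 e₀ hP he₀ h0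
    have := h k n 𝔭 e₀ hP he₀ (fun e' he' => by
      have : e' = 0 := by omega
      subst this; exact h0)
    simpa using this
  · intro h k _ _ n 𝔭 e₀ hP he₀ hne
    have := h k n 𝔭 e₀ hP he₀ (hne 0 Nat.zero_lt_one)
    simpa using this

end Summit.ResolutionOfSingularities.KangarooAtlas.Mizutani
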